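import Summits.BirchSwinnertonDyer.BirchSwinnertonDyer.Theorems.KolyvaginRoadThreeClassCertificate
import Summits.BirchSwinnertonDyer.BirchSwinnertonDyer.Theorems.ErratumRoadFiveNonSurjCornerKolyJProp44StandingInputs
import Summits.BirchSwinnertonDyer.Rank1Residual.X11b.RingClassFieldNoTorsion
import Summits.BirchSwinnertonDyer.Rank1Residual.X11b.Three.KolyvaginLine
import Literature.NumberTheory.EllipticCurves.HeegnerPointsOfConductorOneRationalityProofs
import Literature.NumberTheory.EllipticCurves.HeegnerPointsOfConductorOneGaloisConjProofs
import Literature.NumberTheory.EllipticCurves.HeegnerPointsOfConductorOneData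
import Literature.NumberTheory.EllipticCurves.BSDSelmerPConverseYanZhuKolyvaginSystemProofs
import HarnessLib

/-!
# Route `AdditiveKolyvaginRoad`, crux `BottomRankOneAdditive` (item stmt-BirchSwinnertonDyer-21397):
# stub GLUE `stub_kolyvaginClassOneOfNotPDiv` of the registered skeleton (line `birth`, v2) — PROVED — and the
# crux's conclusion READ AS A POINT-DIVISIBILITY STATEMENT at conductor `1`
# (cell `pub/bsd-wall`, lead prover `bsd-wall-akr-p3` g0; `--supports stmt-BirchSwinnertonDyer-21397`, stub GLUE)

THEOREMS ONLY (no definition, no named fact, no `sorry`); nothing about Kolyvagin's conjecture at an additive prime is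
asserted; BSD is not proved by any of this.

The crux `Theses.AdditiveKolyvaginRoad.BottomRankOneAdditive` (Kolyvagin's conjecture AT THE BOTTOM at an additive
`p ≥ 5`: on every ♯ frame with `#Sel_p(E/K) = p`, `∃ d : KolyvaginHeegnerData Dt β ι 1, d.kolyvaginClass _ 1 ≠ 0`)
concludes a NON-ZERO McCallum cocycle class `c(1) ∈ H¹(K, E[p])`. Every anchor in print or preprint (Skinner–Urban,
Skinner–Zhang, Fouquet–Wan, BCGS; the Gross–Zagier ∕ BSD comparison) delivers instead the POINT statement «the Heegner
point `y_K = P(1)` is not divisible by `p`». This file proves, from tree theorems only, that at conductor `1` the two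
currencies agree on the crux's frames, and lands the glue stub of the lead's skeleton v2:

* §1 `kolyvaginClass_one_ne_zero_of_not_pDiv` ∕ `kolyvaginClass_one_ne_zero_iff_not_pDiv` — for `p ≥ 5` with
  `ρ̄_{E,p}` onto, `K` imaginary quadratic with `d_K < −4` and the Heegner hypothesis for `N_E`, and ANY conductor-`1`
  datum `d`: `c(1) ≠ 0 ↔ P(1) ∉ p·E(K[1])` (`¬ Koly.PDiv d p 1`). Ingredients: McCallum 1991 Cor. 4.5 both ways for
  concrete data (`KolyCert.kolyvaginClass_ne_zero_iff`, zhang3-p1), Gross 1991 Lemma 4.3 at the ring class field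
  from `ρ̄` onto (`RingClassNoTorsion.isAdmissible_pointsSubgroup`, x11b3), Gross Prop. 3.6 ∕ McCallum (4) at level `1`
  (`Theorems.Prop44.toGeomPoints_derivedPoint_mem_invPoints` with `n = 1`, corner-p1).
* §2 `nonempty_kolyvaginHeegnerData_one` — a conductor-`1` datum EXISTS on every frame (Darmon 2004 Thm. 3.6 at
  conductor `1`, PROVED in the tree: `exists_kolyvaginHeegnerData_one` ∘ `phi_heegnerTau_mem_singularModuliField_holds`);
  `derivedPoint_eq_derivedPoint_one` ∕ `pDiv_one_iff_pDiv_one` — `P(1)` and its `p`-divisibility do NOT depend on the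
  datum (`y(1)` is pinned by `map_y`, `S = 𝒢_1` is forced: `KolyvaginHeegnerData.mem_S_iff`).
* §3 `pDiv_one_iff_exists_zsmul_eq_of_surj` — descent to `E(K)`: for `P₀ ∈ E(K)` over `P(1)`,
  `p ∣ P(1)` in `E(K[1])` iff `p ∣ P₀` in `E(K)` (McCallum Lemma 5.1, first display: `Koly.pDiv_one_iff_exists_zsmul_eq`
  with `E(K[1])[p] = 0` from `ρ̄` onto); `exists_isHeegnerPoint_map_eq_derivedPoint_one` — such a `P₀` exists and is a
  Heegner point of level `N_E` (Shimura reciprocity at conductor `1`, PROVED: `heegnerPointOfConductor_one_galoisConj_holds`).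
* §4 `stub_kolyvaginClassOneOfNotPDiv` — the registered glue stub VERBATIM: frame binders → (`∀ d, ¬ Koly.PDiv d p 1`)
  → `∃ d, d.kolyvaginClass _ 1 ≠ 0`.
* §5 `exists_kolyvaginClass_one_ne_zero_iff_forall_not_pDiv` — on the crux's frames the crux's conclusion is
  EQUIVALENT to the open stubs' conclusion (`∃ d, c(1) ≠ 0 ↔ ∀ d, P(1) ∉ p·E(K[1])`): the reshape v1 → v2 loses nothing.

References (locators only): [cite: McCallumLMS1991, §4 (4)–(6), Cor. 4.5, §5 Lemma 5.1] [cite: GrossLMS1991, §3, §4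
(4.1)–(4.4), Lemma 4.3, Prop. 3.6, Prop. 4.7 (1)] [cite: Darmon2004, Thm. 3.6, Thm. 3.7] [cite: WZhang2014, §3.7 (3.21)–(3.22)].
-/

-- single-conjunct summit: `Summit.BirchSwinnertonDyer.BirchSwinnertonDyer.…` repeats the name by design
set_option linter.dupNamespace false

set_option autoImplicit false

noncomputable section

open scoped Classical

namespace Summit.BirchSwinnertonDyer.BirchSwinnertonDyer.Theorems.AdditiveKoly

open WeierstrassCurve NumberField Field
  Literature.NumberTheory.EllipticCurves Literature.NumberTheory.EllipticCurves.ModularForms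
  Literature.NumberTheory.EllipticCurves.Rank1Residual Literature.NumberTheory.EllipticCurves.KolyvaginCocycle
  Summit.BirchSwinnertonDyer.Rank1Residual Summit.BirchSwinnertonDyer.Rank1Residual.X11b
  Summit.BirchSwinnertonDyer.Rank1Residual.X11b.Three

section Frame

-- `K : Type`: the tree's ring-class class field theory is universe `0` (as in the crux).
variable (W : WeierstrassCurve ℚ) [W.IsElliptic] [W.IsGloballyMinimal] [NeZero (W.conductorNorm ℤ)]
  (p : ℕ) [hp : Fact p.Prime] (K : Type) [Field K] [NumberField K]
  (Dt : ModularParametrizationData W (W.conductorNorm ℤ)) (β : ℤ) (ι : K →+* ℂ)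

/-! ## §1 `c(1) ≠ 0 ↔ P(1) ∉ p·E(K[1])` for every conductor-`1` datum -/

/-- **A point certificate at conductor `1` gives a non-zero bottom class** (McCallum 1991, Cor. 4.5 «`c_M(n) = 0` iff
`P_n ∈ p^M E(K_n)`» at `n = M = 1`, with its two standing inputs SUPPLIED): for `p ≥ 5` with `ρ̄_{E,p}` onto, `K`
imaginary quadratic with `d_K < −4` and the Heegner hypothesis for `N_E`, and a conductor-`1` Kolyvagin–Heegner datum
`d` on the frame `(Dt, β, ι)`, if `P(1) ∉ p·E(K[1])` (`¬ Koly.PDiv d p 1`) then `d.kolyvaginClass _ 1 ≠ 0`.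
Admissibility of `E(K[1]) ⊆ E(K̄)` for `p` is Gross's Lemma 4.3 from `ρ̄` onto
(`RingClassNoTorsion.isAdmissible_pointsSubgroup`); `Γ_K`-invariance of `[P(1)]` mod `p` is Gross's Prop. 3.6 at level
`1` (`Theorems.Prop44.toGeomPoints_derivedPoint_mem_invPoints`, no Kolyvagin prime divides `1`); then
`KolyCert.kolyvaginClass_ne_zero_iff`. [cite: McCallumLMS1991, §4 (4)–(5) and Cor. 4.5]
[cite: GrossLMS1991, Lemma 4.3, Prop. 3.6, Prop. 4.7 (1)] -/
theorem kolyvaginClass_one_ne_zero_of_not_pDiv (hp5 : 5 ≤ p) (hs : W.HasSurjectiveModNGaloisRep p)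
    (hK : IsImaginaryQuadratic K) (hlt : NumberField.discr K < -4)
    (hH : SatisfiesHeegnerHypothesis (W.conductorNorm ℤ) K)
    (d : KolyvaginHeegnerData Dt β ι 1) (hcert : ¬ Koly.PDiv d p 1) :
    d.kolyvaginClass hp.out 1 ≠ 0 := by
  have hp2 : p ≠ 2 := by omega
  have hA : IsAdmissible (absoluteGaloisGroup K) d.pointsSubgroup ((p ^ 1 : ℕ) : ℤ) :=
    RingClassNoTorsion.isAdmissible_pointsSubgroup d hK one_ne_zero hp.out hp2 hs 1
  have hP : d.toGeomPoints d.derivedPoint ∈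
      invPoints (absoluteGaloisGroup K) d.pointsSubgroup ((p ^ 1 : ℕ) : ℤ) :=
    Theorems.Prop44.toGeomPoints_derivedPoint_mem_invPoints hK ι hlt hH Dt hp.out squarefree_one
      (fun q hq ↦ by simp [Nat.primeFactors_one] at hq) d
  exact (KolyCert.kolyvaginClass_ne_zero_iff d hp.out 1).mpr ⟨hA, hP, hcert⟩

/-- **`c(1) ≠ 0 ↔ P(1) ∉ p·E(K[1])` at conductor `1`** on the crux's frames (`p ≥ 5`, `ρ̄_{E,p}` onto, `K` imaginary
quadratic, `d_K < −4`, Heegner hypothesis), for EVERY conductor-`1` datum: McCallum 1991 Cor. 4.5 with both standing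
inputs supplied (`⇒`: a non-zero class is a certificate, `Koly.not_pDiv_of_kolyvaginClass_ne_zero`; `⇐`:
`kolyvaginClass_one_ne_zero_of_not_pDiv`). [cite: McCallumLMS1991, Cor. 4.5] [cite: GrossLMS1991, Prop. 4.7 (1)] -/
theorem kolyvaginClass_one_ne_zero_iff_not_pDiv (hp5 : 5 ≤ p) (hs : W.HasSurjectiveModNGaloisRep p)
    (hK : IsImaginaryQuadratic K) (hlt : NumberField.discr K < -4)
    (hH : SatisfiesHeegnerHypothesis (W.conductorNorm ℤ) K) (d : KolyvaginHeegnerData Dt β ι 1) :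
    d.kolyvaginClass hp.out 1 ≠ 0 ↔ ¬ Koly.PDiv d p 1 :=
  ⟨fun h ↦ Koly.not_pDiv_of_kolyvaginClass_ne_zero d h,
    kolyvaginClass_one_ne_zero_of_not_pDiv W p K Dt β ι hp5 hs hK hlt hH d⟩

/-! ## §2 The conductor-`1` datum exists; `P(1)` does not depend on it -/

omit [W.IsGloballyMinimal] hp in
/-- **A conductor-`1` Kolyvagin–Heegner datum exists on every frame** (Gross 1991 §§3–4 at `n = 1`; the one
non-elementary field `y(1) ∈ E(K[1])` is Darmon 2004 Thm. 3.6 at conductor `1`, PROVED in the tree as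
`phi_heegnerTau_mem_singularModuliField_holds`, fed to `exists_kolyvaginHeegnerData_one`): for `E/ℚ` elliptic, `K`
imaginary quadratic, a parametrisation datum `Dt` at level `N_E`, an orientation `β` with `4N_E ∣ β² − d_K` and an
embedding `ι`. [cite: Darmon2004, Thm. 3.6] [cite: GrossLMS1991, §3–§4 (4.1)] -/
theorem nonempty_kolyvaginHeegnerData_one (hK : IsImaginaryQuadratic K)
    (hβ : (4 * (W.conductorNorm ℤ : ℕ) : ℤ) ∣ β ^ 2 - NumberField.discr K) :
    Nonempty (KolyvaginHeegnerData Dt β ι 1) :=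
  exists_kolyvaginHeegnerData_one (phi_heegnerTau_mem_singularModuliField_holds (W.conductorNorm ℤ) W K) hK Dt β ι hβ

omit [W.IsElliptic] [W.IsGloballyMinimal] hp in
/-- **`P(1)` does not depend on the conductor-`1` datum**: two data `d, d'` on the same frame `(Dt, β, ι)` have the
same `y(1)` (both map to `φ(x(1))` under the injective `E(K[1]) → E(ℂ)`) and the same transversal `S = 𝒢_1`
(`KolyvaginHeegnerData.mem_S_iff`), hence the same `P(1) = Σ_{s ∈ 𝒢_1} s y(1) = Tr_{K[1]/K} y(1)` (Gross 1991 §4: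
«`P_1 = Tr_{K_1/K}(y_1) = y_K`»). [cite: GrossLMS1991, §4 (P_1 = y_K)] -/
theorem derivedPoint_one_eq_derivedPoint_one (d d' : KolyvaginHeegnerData Dt β ι 1) :
    d.derivedPoint = d'.derivedPoint := by
  have hy : d.y = d'.y :=
    WeierstrassCurve.Affine.Point.map_injective (W' := W) (ringClassField K ι 1).subtype.toRatAlgHom
      (d.map_y.trans d'.map_y.symm)
  have hS : d.S = d'.S := by
    ext s
    rw [d.mem_S_iff, d'.mem_S_iff]
  rw [d.derivedPoint_one, d'.derivedPoint_one, hy, hS]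

omit [W.IsElliptic] [W.IsGloballyMinimal] hp in
/-- **`p^M ∣ P(1)` does not depend on the conductor-`1` datum** (corollary of `derivedPoint_one_eq_derivedPoint_one`):
the open stubs' `∀ d, ¬ Koly.PDiv d p 1` and `∃ d, ¬ Koly.PDiv d p 1` say the same thing once a datum exists.
[cite: GrossLMS1991, §4 (P_1 = y_K)] -/
theorem pDiv_one_iff_pDiv_one (d d' : KolyvaginHeegnerData Dt β ι 1) (M : ℕ) :
    Koly.PDiv d p M ↔ Koly.PDiv d' p M := by
  unfold Koly.PDiv
  rw [derivedPoint_one_eq_derivedPoint_one W K Dt β ι d d']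

/-! ## §3 Descent to `E(K)`: `p ∣ P(1)` in `E(K[1])` iff `p ∣ y_K` in `E(K)` -/

omit [W.IsGloballyMinimal] in
/-- **McCallum 1991, Lemma 5.1 (first display) with Gross's Lemma 4.3 SUPPLIED**: for `p` odd with `ρ̄_{E,p}` onto, `K`
imaginary quadratic, a conductor-`1` datum `d` and a point `P₀ ∈ E(K)` mapping to `P(1) ∈ E(K[1])`, `p^M ∣ P(1)` in
`E(K[1])` iff `p^M ∣ P₀` in `E(K)` — «since `E(K_1)` has no `p`-torsion, `E(K)/p^M E(K)` injects into
`E(K_1)/p^M E(K_1)`» (`Koly.pDiv_one_iff_exists_zsmul_eq`, its `htor` from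
`RingClassNoTorsion.eq_zero_of_zsmul_pow_eq_zero_ringClassField`). [cite: McCallumLMS1991, §5 Lemma 5.1]
[cite: GrossLMS1991, Lemma 4.3] -/
theorem pDiv_one_iff_exists_zsmul_eq_of_surj (hp2 : p ≠ 2) (hs : W.HasSurjectiveModNGaloisRep p)
    (hK : IsImaginaryQuadratic K) (d : KolyvaginHeegnerData Dt β ι 1)
    (P₀ : (W.baseChange K).toAffine.Point)
    (hP₀ : WeierstrassCurve.Affine.Point.map (W' := W) (algebraMap K (ringClassField K ι 1)).toRatAlgHom P₀ =
      d.derivedPoint) (M : ℕ) :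
    Koly.PDiv d p M ↔ ∃ Q : (W.baseChange K).toAffine.Point, ((p ^ M : ℕ) : ℤ) • Q = P₀ :=
  Koly.pDiv_one_iff_exists_zsmul_eq hK d P₀ hP₀ p M
    fun R hR ↦ RingClassNoTorsion.eq_zero_of_zsmul_pow_eq_zero_ringClassField W hK ι one_ne_zero hp.out hp2 hs M R hR

omit [W.IsGloballyMinimal] hp in
/-- **`P(1)` descends to a Heegner point `y_K ∈ E(K)`** (Gross 1991 §4 «`P_1 = Tr_{K_1/K} y_1 = y_K`»; Darmon 2004
Thm. 3.7): for `K` imaginary quadratic with the Heegner hypothesis for `N_E` and a conductor-`1` datum `d`, some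
`P₀ ∈ E(K)` is a Heegner point of level `N_E` (`IsHeegnerPoint`) and maps to `P(1)`
(`heegnerSystem_exists_isHeegnerPoint_map_eq_derivedPoint_one`, its Shimura-reciprocity input PROVED in the tree as
`heegnerPointOfConductor_one_galoisConj_holds`). [cite: GrossLMS1991, §4 (P_1 = y_K)] [cite: Darmon2004, Thm. 3.7] -/
theorem exists_isHeegnerPoint_map_eq_derivedPoint_one (hK : IsImaginaryQuadratic K)
    (hH : SatisfiesHeegnerHypothesis (W.conductorNorm ℤ) K) (d : KolyvaginHeegnerData Dt β ι 1) :
    ∃ P₀ : (W.baseChange K).toAffine.Point, IsHeegnerPoint (W.conductorNorm ℤ) W K P₀ ∧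
      WeierstrassCurve.Affine.Point.map (W' := W) (algebraMap K (ringClassField K ι 1)).toRatAlgHom P₀ =
        d.derivedPoint :=
  heegnerSystem_exists_isHeegnerPoint_map_eq_derivedPoint_one
    (heegnerPointOfConductor_one_galoisConj_holds (W.conductorNorm ℤ) W K) hK hH d

/-- **The crux's bottom class read on `E(K)`**: on the crux's frames (`p ≥ 5`, `ρ̄_{E,p}` onto, `K` imaginary
quadratic, `d_K < −4`, Heegner hypothesis), for a conductor-`1` datum `d` and `P₀ ∈ E(K)` over `P(1)`:
`c(1) ≠ 0 ↔ P₀ ∉ p·E(K)`. (§1 ∘ §3 at `M = 1`.) [cite: McCallumLMS1991, Cor. 4.5 and Lemma 5.1]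
[cite: GrossLMS1991, §4 (4.4), Lemma 4.3] -/
theorem kolyvaginClass_one_ne_zero_iff_not_exists_zsmul_eq (hp5 : 5 ≤ p) (hs : W.HasSurjectiveModNGaloisRep p)
    (hK : IsImaginaryQuadratic K) (hlt : NumberField.discr K < -4)
    (hH : SatisfiesHeegnerHypothesis (W.conductorNorm ℤ) K) (d : KolyvaginHeegnerData Dt β ι 1)
    (P₀ : (W.baseChange K).toAffine.Point)
    (hP₀ : WeierstrassCurve.Affine.Point.map (W' := W) (algebraMap K (ringClassField K ι 1)).toRatAlgHom P₀ =
      d.derivedPoint) :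
    d.kolyvaginClass hp.out 1 ≠ 0 ↔ ¬ ∃ Q : (W.baseChange K).toAffine.Point, (p : ℤ) • Q = P₀ := by
  have h1 := pDiv_one_iff_exists_zsmul_eq_of_surj W p K Dt β ι (by omega) hs hK d P₀ hP₀ 1
  rw [pow_one] at h1
  rw [kolyvaginClass_one_ne_zero_iff_not_pDiv W p K Dt β ι hp5 hs hK hlt hH d, h1]

end Frame

/-! ## §4 The registered glue stub, verbatim -/

section Stub

/-- **Stub GLUE `stub_kolyvaginClassOneOfNotPDiv` of skeleton v2 (line `birth`) of crux `BottomRankOneAdditive`,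
VERBATIM and UNCONDITIONAL**: on a frame with `p ≥ 5`, `ρ̄_{E,p}` onto, `K` imaginary quadratic, `d_K < −4`, the Heegner
hypothesis for `N_E` and `4N_E ∣ β² − d_K`, if `P(1) ∉ p·E(K[1])` for EVERY conductor-`1` Kolyvagin–Heegner datum on
`(Dt, β, ι)` then SOME conductor-`1` datum has `c(1) = d.kolyvaginClass _ 1 ≠ 0` in `H¹(K, E[p])` — a datum exists
(`nonempty_kolyvaginHeegnerData_one`, Darmon Thm. 3.6) and its class is non-zero by §1 (McCallum Cor. 4.5 with Gross
Lemma 4.3 and Prop. 3.6 supplied). [cite: McCallumLMS1991, Cor. 4.5] [cite: GrossLMS1991, Lemma 4.3, Prop. 3.6, §4 (4.4)]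
[cite: Darmon2004, Thm. 3.6] -/
theorem stub_kolyvaginClassOneOfNotPDiv :
  ∀ (W : WeierstrassCurve ℚ) [W.IsElliptic] [W.IsGloballyMinimal] [NeZero (W.conductorNorm ℤ)]
    (p : ℕ) [Fact p.Prime] (K : Type) [Field K] [NumberField K]
    (Dt : ModularParametrizationData W (W.conductorNorm ℤ)) (β : ℤ) (ι : K →+* ℂ),
    5 ≤ p → W.HasSurjectiveModNGaloisRep p → IsImaginaryQuadratic K → NumberField.discr K < -4 →
    SatisfiesHeegnerHypothesis (W.conductorNorm ℤ) K →
    (4 * (W.conductorNorm ℤ : ℤ)) ∣ β ^ 2 - NumberField.discr K →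
    (∀ d : KolyvaginHeegnerData Dt β ι 1, ¬ Koly.PDiv d p 1) →
    ∃ d : KolyvaginHeegnerData Dt β ι 1, d.kolyvaginClass (Fact.out : p.Prime) 1 ≠ 0 := by
  intro W _ _ _ p _ K _ _ Dt β ι hp5 hs hK hlt hH hβ hpt
  obtain ⟨d⟩ := nonempty_kolyvaginHeegnerData_one W K Dt β ι hK hβ
  exact ⟨d, kolyvaginClass_one_ne_zero_of_not_pDiv W p K Dt β ι hp5 hs hK hlt hH d (hpt d)⟩

end Stub

/-! ## §5 The reshape v1 → v2 loses nothing: `∃ d, c(1) ≠ 0 ↔ ∀ d, P(1) ∉ p·E(K[1])` on the crux's frames -/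

section Equivalence

variable (W : WeierstrassCurve ℚ) [W.IsElliptic] [W.IsGloballyMinimal] [NeZero (W.conductorNorm ℤ)]
  (p : ℕ) [hp : Fact p.Prime] (K : Type) [Field K] [NumberField K]
  (Dt : ModularParametrizationData W (W.conductorNorm ℤ)) (β : ℤ) (ι : K →+* ℂ)

/-- **On the crux's frames, the crux's conclusion `∃ d, c(1) ≠ 0` is EQUIVALENT to the open stubs' conclusion
`∀ d, ¬ Koly.PDiv d p 1`** (`p ≥ 5`, `ρ̄_{E,p}` onto, `K` imaginary quadratic, `d_K < −4`, Heegner hypothesis,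
`4N_E ∣ β² − d_K`): `⇐` is the glue stub; `⇒`: a non-zero class is a point certificate for its datum (§1) and the
certificate transfers to every datum (`pDiv_one_iff_pDiv_one`). A REFORMULATION: nothing is asserted about either side.
[cite: McCallumLMS1991, Cor. 4.5] [cite: GrossLMS1991, §4 (P_1 = y_K), Prop. 4.7 (1)] -/
theorem exists_kolyvaginClass_one_ne_zero_iff_forall_not_pDiv (hp5 : 5 ≤ p) (hs : W.HasSurjectiveModNGaloisRep p)
    (hK : IsImaginaryQuadratic K) (hlt : NumberField.discr K < -4)
    (hH : SatisfiesHeegnerHypothesis (W.conductorNorm ℤ) K)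
    (hβ : (4 * (W.conductorNorm ℤ : ℤ)) ∣ β ^ 2 - NumberField.discr K) :
    (∃ d : KolyvaginHeegnerData Dt β ι 1, d.kolyvaginClass hp.out 1 ≠ 0) ↔
      ∀ d : KolyvaginHeegnerData Dt β ι 1, ¬ Koly.PDiv d p 1 := by
  constructor
  · rintro ⟨d, hd⟩ d'
    rw [← pDiv_one_iff_pDiv_one W p K Dt β ι d d' 1]
    exact (kolyvaginClass_one_ne_zero_iff_not_pDiv W p K Dt β ι hp5 hs hK hlt hH d).mp hd
  · exact stub_kolyvaginClassOneOfNotPDiv W p K Dt β ι hp5 hs hK hlt hH hβ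

end Equivalence

end Summit.BirchSwinnertonDyer.BirchSwinnertonDyer.Theorems.AdditiveKoly

end
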